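import Literature.Computability.AlgebraicComplexity.HI16DetSkewCircuitProofs
import Literature.Computability.AlgebraicComplexity.ArithCircuitProofs
import Literature.Computability.AlgebraicComplexity.ValiantClasses
import HarnessLib

/-!
# The 231-avoiding block DP is a `VP` circuit (support for `FifoMatching.Av231InVP`)

Helper toward route item `stmt-ValiantsHypothesis-11620` (`Theses.FifoMatching.Av231InVP`): the
block dynamic programme over (first position `p`, least value `v`, size `m`)
`A[p;v;m] = Σ_{k<m} x_{p+k, v+m-1} · A[p;v;k] · A[p+k+1; v+k; m-1-k]`, `A[p;v;0] = 1`
(split a 231-avoiding bijection `[p,p+m) → [v,v+m)` at the position `p+k` of its maximum: the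
values left of the maximum are exactly `[v,v+k)`), compiled to a fan-in-two arithmetic circuit with
`O(n⁴)` gates by the register-program framework `ArithCircuit.RegProg`
(`HI16DetSkewCircuitProofs.lean`): `complexity ≤ 4 (n+1)⁴`, degree `≤ n`, so `isVPFamily_avRec`;
the identification with the item's sum is the sibling step. [folklore; Bürgisser 2000 Def. 2.1–2.4]
-/

noncomputable section

-- layout Summits/ValiantsHypothesis/ValiantsHypothesis forces the duplicated namespace component
set_option linter.dupNamespace false

namespace Summit.ValiantsHypothesis.ValiantsHypothesis.Theorems.FifoMatching

open Literature.Computability.AlgebraicComplexity MvPolynomial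
open Literature.Computability.AlgebraicComplexity.ArithCircuit

universe u

variable (k : Type u) [CommSemiring k]

/-! ### The DP polynomials -/

/-- The variable `x_{i,a}` of the `n × n` matrix (`0` out of range). [folklore] -/
def xa (n i a : ℕ) : MvPolynomial (Fin n × Fin n) k :=
  if h : i < n ∧ a < n then X (⟨i, h.1⟩, ⟨a, h.2⟩) else 0

/-- **The block DP** `A[p;v;m] = Σ_{k<m} x_{p+k,v+m-1} A[p;v;k] A[p+k+1;v+k;m-1-k]`, `A[p;v;0] = 1`
(231-avoiding bijections `[p,p+m) → [v,v+m)`, by the position `p+k` of the maximum). [folklore] -/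
def avRec (n : ℕ) : ℕ → ℕ → ℕ → MvPolynomial (Fin n × Fin n) k
  | _, _, 0 => 1
  | p, v, m + 1 =>
    ∑ a ∈ (Finset.range (m + 1)).attach,
      xa k n (p + a.1) (v + m) * avRec n p v a.1 * avRec n (p + a.1 + 1) (v + a.1) (m - a.1)
  termination_by _ _ m => m
  decreasing_by
    all_goals
      have ha := Finset.mem_range.mp a.2
      omega

/-- One summand of the DP: `x_{p+a,v+m-1} A[p;v;a] A[p+a+1;v+a;m-1-a]`. [folklore] -/
def avTerm (n p v m a : ℕ) : MvPolynomial (Fin n × Fin n) k :=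
  xa k n (p + a) (v + m - 1) * avRec k n p v a * avRec k n (p + a + 1) (v + a) (m - 1 - a)

variable {k}

/-- The DP equation on a nonempty block. [folklore] -/
theorem avRec_of_pos (n : ℕ) {p v m : ℕ} (h : 0 < m) :
    avRec k n p v m = ∑ a ∈ Finset.range m, avTerm k n p v m a := by
  obtain ⟨m, rfl⟩ : ∃ m', m = m' + 1 := ⟨m - 1, by omega⟩
  rw [avRec, Finset.sum_attach (Finset.range (m + 1))
    (fun a => xa k n (p + a) (v + m) * avRec k n p v a * avRec k n (p + a + 1) (v + a) (m - a))]
  refine Finset.sum_congr rfl fun a _ => ?_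
  simp only [avTerm, show v + (m + 1) - 1 = v + m by omega, show m + 1 - 1 - a = m - a by omega]

/-- The DP on an empty block. [folklore] -/
theorem avRec_zero (n p v : ℕ) : avRec k n p v 0 = 1 := by
  rw [avRec]

/-- Registers: `av p v m` = `A[p;v;m]`; `pr1 p v m a` = `x_{p+a,v+m-1} A[p;v;a]`; `pr2 p v m a` = the
full summand; `acc p v m a` = the partial sum over `a' < a`. [folklore] -/
inductive AReg : Type
  /-- the block value `A[p;v;m]` -/
  | av (p v m : ℕ) : AReg
  /-- the partial product `x_{p+a,v+m-1} A[p;v;a]` -/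
  | pr1 (p v m a : ℕ) : AReg
  /-- the full summand -/
  | pr2 (p v m a : ℕ) : AReg
  /-- the partial sum of the summands over `a' < a` -/
  | acc (p v m a : ℕ) : AReg
  deriving DecidableEq

variable (k)
variable (n : ℕ)

/-- The input operand `x_{i,a}` (constant `0` out of range). [folklore] -/
def axop (i a : ℕ) : ROperand k (Fin n × Fin n) AReg :=
  if h : i < n ∧ a < n then .var (⟨i, h.1⟩, ⟨a, h.2⟩) else .const 0

/-- The defining gates (all of fan-in at most two). [folklore] -/
def agateOf : AReg → RGate k (Fin n × Fin n) AReg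
  | .av p v m => if 0 < m then .sum [(1, .reg (.acc p v m m))] else .sum [(1, .const 1)]
  | .pr1 p v m a => .prod [axop k n (p + a) (v + m - 1), .reg (.av p v a)]
  | .pr2 p v m a => .prod [.reg (.pr1 p v m a), .reg (.av (p + a + 1) (v + a) (m - 1 - a))]
  | .acc p v m a => if a = 0 then .sum []
      else .sum [(1, .reg (.acc p v m (a - 1))), (1, .reg (.pr2 p v m (a - 1)))]

/-- The rank: by block size `m` (scaled by `n + 4`), then products, partial sums, and the block
value last. [folklore] -/
def arank : AReg → ℕ
  | .av _ _ m => m * (n + 4) + m + 3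
  | .pr1 _ _ m _ => m * (n + 4)
  | .pr2 _ _ m _ => m * (n + 4) + 1
  | .acc _ _ m a => m * (n + 4) + 2 + a

/-- The intended values of the registers. [folklore] -/
def aval : AReg → MvPolynomial (Fin n × Fin n) k
  | .av p v m => avRec k n p v m
  | .pr1 p v m a => xa k n (p + a) (v + m - 1) * avRec k n p v a
  | .pr2 p v m a => avTerm k n p v m a
  | .acc p v m a => ∑ a' ∈ Finset.range a, avTerm k n p v m a'

/-- The block registers `av p v m`, `p + m ≤ n`, `v + m ≤ n`. [folklore] -/
def avRegs : List AReg :=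
  (List.range (n + 1)).flatMap fun m => (List.range (n + 1 - m)).flatMap fun p =>
    (List.range (n + 1 - m)).map fun v => .av p v m

/-- The product registers, `a < m`. [folklore] -/
def aprRegs : List AReg :=
  (List.range (n + 1)).flatMap fun m => (List.range (n + 1 - m)).flatMap fun p =>
    (List.range (n + 1 - m)).flatMap fun v => (List.range m).flatMap fun a =>
      [.pr1 p v m a, .pr2 p v m a]

/-- The partial-sum registers `acc p v m a`, `a ≤ m`. [folklore] -/
def aaccRegs : List AReg :=
  (List.range (n + 1)).flatMap fun m => (List.range (n + 1 - m)).flatMap fun p =>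
    (List.range (n + 1 - m)).flatMap fun v => (List.range (m + 1)).map fun a => .acc p v m a

/-- All registers. [folklore] -/
def aregs : List AReg := avRegs n ++ aprRegs n ++ aaccRegs n

/-- **The register program for `A[0;0;n]`.** [folklore] -/
def aprog : RegProg k (Fin n × Fin n) AReg where
  regs := aregs n
  rank := arank n
  gateOf := agateOf k n
  output := .reg (.av 0 0 n)

variable {k n}

/-- The block registers present. [folklore] -/
theorem mem_aregs_av {p v m : ℕ} : AReg.av p v m ∈ aregs n ↔ p + m ≤ n ∧ v + m ≤ n := by
  simp only [aregs, avRegs, aprRegs, aaccRegs, List.mem_append, List.mem_flatMap, List.mem_range,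
    List.mem_map, List.mem_cons, List.not_mem_nil, AReg.av.injEq, reduceCtorEq, or_false,
    and_false, exists_false, or_self]
  constructor
  · rintro ⟨m', hm', p', hp', v', hv', rfl, rfl, rfl⟩; omega
  · rintro ⟨h1, h2⟩; exact ⟨m, by omega, p, by omega, v, by omega, rfl, rfl, rfl⟩

/-- The first-product registers present. [folklore] -/
theorem mem_aregs_pr1 {p v m a : ℕ} :
    AReg.pr1 p v m a ∈ aregs n ↔ p + m ≤ n ∧ v + m ≤ n ∧ a < m := by
  simp only [aregs, avRegs, aprRegs, aaccRegs, List.mem_append, List.mem_flatMap, List.mem_range,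
    List.mem_map, List.mem_cons, List.not_mem_nil, AReg.pr1.injEq, reduceCtorEq, or_false,
    and_false, exists_false, or_self, false_or]
  constructor
  · rintro ⟨m', hm', p', hp', v', hv', a', ha', rfl, rfl, rfl, rfl⟩; omega
  · rintro ⟨h1, h2, h3⟩; exact ⟨m, by omega, p, by omega, v, by omega, a, h3, rfl, rfl, rfl, rfl⟩

/-- The summand registers present. [folklore] -/
theorem mem_aregs_pr2 {p v m a : ℕ} :
    AReg.pr2 p v m a ∈ aregs n ↔ p + m ≤ n ∧ v + m ≤ n ∧ a < m := by
  simp only [aregs, avRegs, aprRegs, aaccRegs, List.mem_append, List.mem_flatMap, List.mem_range,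
    List.mem_map, List.mem_cons, List.not_mem_nil, AReg.pr2.injEq, reduceCtorEq, or_false,
    and_false, exists_false, false_or]
  constructor
  · rintro ⟨m', hm', p', hp', v', hv', a', ha', rfl, rfl, rfl, rfl⟩; omega
  · rintro ⟨h1, h2, h3⟩; exact ⟨m, by omega, p, by omega, v, by omega, a, h3, rfl, rfl, rfl, rfl⟩

/-- The partial-sum registers present. [folklore] -/
theorem mem_aregs_acc {p v m a : ℕ} :
    AReg.acc p v m a ∈ aregs n ↔ p + m ≤ n ∧ v + m ≤ n ∧ a ≤ m := by
  simp only [aregs, avRegs, aprRegs, aaccRegs, List.mem_append, List.mem_flatMap, List.mem_range,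
    List.mem_map, List.mem_cons, List.not_mem_nil, AReg.acc.injEq, reduceCtorEq,
    and_false, exists_false, or_self, false_or]
  constructor
  · rintro ⟨m', hm', p', hp', v', hv', a', ha', rfl, rfl, rfl, rfl⟩; omega
  · rintro ⟨h1, h2, h3⟩; exact ⟨m, by omega, p, by omega, v, by omega, a, by omega, rfl, rfl, rfl, rfl⟩

/-- The input operand reads the variable `x_{i,a}` (or `0`). [folklore] -/
theorem eval_axop (V : AReg → MvPolynomial (Fin n × Fin n) k) (i a : ℕ) :
    (axop k n i a).eval V = xa k n i a := by
  unfold axop xa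
  split_ifs <;> simp [ROperand.eval]

/-- **The local equations hold** for every register. [folklore] -/
theorem arealizes : (aprog k n).Realizes (aval k n) := by
  intro r
  change (agateOf k n r).eval (aval k n) = aval k n r
  rcases r with ⟨p, v, m⟩ | ⟨p, v, m, a⟩ | ⟨p, v, m, a⟩ | ⟨p, v, m, a⟩
  · by_cases h : 0 < m
    · rw [agateOf, if_pos h, aval, avRec_of_pos n h]
      simp [RGate.eval, aval]
    · rw [agateOf, if_neg h, aval, show m = 0 by omega, avRec_zero]
      simp [RGate.eval]
  · simp only [agateOf, RGate.eval, List.map_cons, List.map_nil, List.prod_cons, List.prod_nil,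
      mul_one, eval_axop, ROperand.eval_reg, aval]
  · simp only [agateOf, RGate.eval, List.map_cons, List.map_nil, List.prod_cons, List.prod_nil,
      mul_one, ROperand.eval_reg, aval, avTerm]
  · by_cases h : a = 0
    · subst h
      rw [agateOf, if_pos rfl, aval, Finset.range_zero, Finset.sum_empty]
      simp [RGate.eval]
    · rw [agateOf, if_neg h, aval]
      obtain ⟨b, rfl⟩ : ∃ b, a = b + 1 := ⟨a - 1, by omega⟩
      rw [Nat.add_sub_cancel, Finset.sum_range_succ]
      simp [RGate.eval, aval]

/-- The input operand reads no register. [folklore] -/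
theorem reads_axop (i a : ℕ) : (axop k n i a).reads = [] := by
  unfold axop
  split_ifs <;> rfl

/-- A rank comparison: a strictly smaller block (of size `≤ n`) ranks below the products of the
block. [folklore] -/
private theorem arank_aux {L L' C n : ℕ} (h : L' + 1 ≤ L) (hn : L' ≤ n) (hC : C = n + 4) :
    L' * C + L' + 3 < L * C := by
  subst hC
  have h1 : (L' + 1) * (n + 4) ≤ L * (n + 4) := Nat.mul_le_mul_right _ h
  rw [Nat.add_mul] at h1
  omega

/-- **The program is well ranked.** [folklore] -/
theorem awellRanked : (aprog k n).WellRanked := by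
  intro r hr r' hr'
  change r ∈ aregs n at hr
  change r' ∈ (agateOf k n r).reads at hr'
  change r' ∈ aregs n ∧ arank n r' < arank n r
  rcases r with ⟨p, v, m⟩ | ⟨p, v, m, a⟩ | ⟨p, v, m, a⟩ | ⟨p, v, m, a⟩
  · rw [mem_aregs_av] at hr
    by_cases h : 0 < m
    · rw [agateOf, if_pos h] at hr'
      simp only [RGate.reads, List.flatMap_cons, List.flatMap_nil, ROperand.reads_reg,
        List.append_nil, List.mem_singleton] at hr'
      subst hr'
      exact ⟨mem_aregs_acc.2 ⟨hr.1, hr.2, le_rfl⟩, by simp only [arank]; omega⟩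
    · rw [agateOf, if_neg h] at hr'
      simp [RGate.reads] at hr'
  · rw [mem_aregs_pr1] at hr
    simp only [agateOf, RGate.reads, List.flatMap_cons, List.flatMap_nil, List.append_nil,
      reads_axop, ROperand.reads_reg, List.nil_append, List.mem_singleton] at hr'
    subst hr'
    refine ⟨mem_aregs_av.2 ⟨by omega, by omega⟩, ?_⟩
    simp only [arank]
    exact arank_aux (by omega) (by omega) rfl
  · rw [mem_aregs_pr2] at hr
    simp only [agateOf, RGate.reads, List.flatMap_cons, List.flatMap_nil, List.append_nil,
      ROperand.reads_reg, List.singleton_append, List.mem_cons, List.not_mem_nil, or_false] at hr'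
    rcases hr' with rfl | rfl
    · exact ⟨mem_aregs_pr1.2 hr, by simp only [arank]; omega⟩
    · refine ⟨mem_aregs_av.2 ⟨by omega, by omega⟩, ?_⟩
      simp only [arank]
      exact (arank_aux (L := m) (L' := m - 1 - a) (C := n + 4) (n := n) (by omega) (by omega)
        rfl).trans (Nat.lt_succ_self _)
  · rw [mem_aregs_acc] at hr
    by_cases h : a = 0
    · subst h
      rw [agateOf, if_pos rfl] at hr'
      simp [RGate.reads] at hr'
    · rw [agateOf, if_neg h] at hr'
      simp only [RGate.reads, List.flatMap_cons, List.flatMap_nil, ROperand.reads_reg,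
        List.append_nil, List.singleton_append, List.mem_cons, List.not_mem_nil, or_false] at hr'
      rcases hr' with rfl | rfl
      · exact ⟨mem_aregs_acc.2 ⟨hr.1, hr.2.1, by omega⟩, by simp only [arank]; omega⟩
      · exact ⟨mem_aregs_pr2.2 ⟨hr.1, hr.2.1, by omega⟩, by simp only [arank]; omega⟩

/-- Every defining gate has fan-in at most two. [folklore] -/
theorem fanIn_agateOf_le (r : AReg) : (agateOf k n r).fanIn ≤ 2 := by
  rcases r with ⟨p, v, m⟩ | ⟨p, v, m, a⟩ | ⟨p, v, m, a⟩ | ⟨p, v, m, a⟩ <;> simp only [agateOf] <;>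
    (try split_ifs) <;> simp [RGate.fanIn]

/-- A triple `flatMap` over ranges of length `≤ n+1` with inner lists of length `≤ B` has length
`≤ (n+1)³ B`. [folklore] -/
private theorem length_flatMap₃_le {α : Type} (B : ℕ) (f : ℕ → ℕ → ℕ → List α)
    (hf : ∀ m p v, m ≤ n → (f m p v).length ≤ B) :
    ((List.range (n + 1)).flatMap fun m => (List.range (n + 1 - m)).flatMap fun p =>
      (List.range (n + 1 - m)).flatMap fun v => f m p v).length ≤ (n + 1) ^ 3 * B := by
  rw [List.length_flatMap]
  refine (List.sum_le_card_nsmul _ ((n + 1) * ((n + 1) * B)) ?_).trans ?_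
  · intro x hx
    simp only [List.mem_map, List.mem_range] at hx
    obtain ⟨m, hm, rfl⟩ := hx
    rw [List.length_flatMap]
    refine (List.sum_le_card_nsmul _ ((n + 1) * B) ?_).trans ?_
    · intro y hy
      simp only [List.mem_map, List.mem_range] at hy
      obtain ⟨p, hp, rfl⟩ := hy
      rw [List.length_flatMap]
      refine (List.sum_le_card_nsmul _ B ?_).trans ?_
      · intro z hz
        simp only [List.mem_map, List.mem_range] at hz
        obtain ⟨v, hv, rfl⟩ := hz
        exact hf m p v (by omega)
      · simp only [List.length_map, List.length_range, smul_eq_mul]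
        exact Nat.mul_le_mul_right _ (by omega)
    · simp only [List.length_map, List.length_range, smul_eq_mul]
      exact Nat.mul_le_mul_right _ (by omega)
  · simp only [List.length_map, List.length_range, smul_eq_mul]
    rw [pow_succ, pow_two]
    simp only [mul_assoc]
    exact le_rfl

/-- The number of registers is at most `4 (n+1)⁴`. [folklore] -/
theorem length_aregs_le : (aregs n).length ≤ 4 * (n + 1) ^ 4 := by
  have h1 : (avRegs n).length ≤ (n + 1) ^ 3 * 1 := by
    unfold avRegs
    refine le_trans (le_of_eq ?_) (length_flatMap₃_le (n := n) 1 (fun m p v => [AReg.av p v m])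
      fun _ _ _ _ => le_rfl)
    congr 1
    refine List.flatMap_congr fun m _ => List.flatMap_congr fun p _ => ?_
    rw [← List.flatMap_pure_eq_map]
    rfl
  have h2 : (aprRegs n).length ≤ (n + 1) ^ 3 * (2 * (n + 1)) := by
    unfold aprRegs
    refine length_flatMap₃_le (n := n) (2 * (n + 1))
      (fun m p v => (List.range m).flatMap fun a => [AReg.pr1 p v m a, .pr2 p v m a]) ?_
    intro m p v hm
    rw [List.length_flatMap]
    refine (List.sum_le_card_nsmul _ 2 ?_).trans ?_
    · intro z hz
      simp only [List.mem_map, List.mem_range] at hz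
      obtain ⟨a, _, rfl⟩ := hz
      simp
    · simp only [List.length_map, List.length_range, smul_eq_mul]
      rw [mul_comm]
      exact Nat.mul_le_mul_left 2 (by omega)
  have h3 : (aaccRegs n).length ≤ (n + 1) ^ 3 * (n + 1) := by
    unfold aaccRegs
    refine length_flatMap₃_le (n := n) (n + 1)
      (fun m p v => (List.range (m + 1)).map fun a => AReg.acc p v m a) ?_
    intro m p v hm
    simp only [List.length_map, List.length_range]
    omega
  rw [aregs, List.length_append, List.length_append]
  nlinarith [h1, h2, h3]

/-- **The DP value `A[0;0;n]` has a fan-in-two circuit of size `≤ 4 (n+1)⁴`.** [folklore] -/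
theorem complexity_avRec_le (n : ℕ) :
    complexity (avRec k n 0 0 n) ≤ 4 * (n + 1) ^ 4 := by
  classical
  have hcomp : (aprog k n).compile.Computes (avRec k n 0 0 n) := by
    rw [ArithCircuit.Computes, RegProg.eval_compile (aprog k n) awellRanked arealizes]
    · rfl
    · intro r' hr'
      simp only [aprog, ROperand.reads_reg, List.mem_singleton] at hr'
      subst hr'
      exact mem_aregs_av.2 ⟨by omega, by omega⟩
  refine (ArithCircuit.complexity_le_size
    (RegProg.isFanInTwo_compile (aprog k n) fun r _ => fanIn_agateOf_le r) hcomp).trans ?_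
  rw [RegProg.size_compile]
  exact length_aregs_le

/-- The DP values have degree at most the block size. [folklore] -/
theorem totalDegree_avRec_le (n : ℕ) :
    ∀ L p v m : ℕ, m ≤ L → (avRec k n p v m).totalDegree ≤ m := by
  intro L
  induction L with
  | zero =>
    intro p v m h
    rw [show m = 0 by omega, avRec_zero]
    simp
  | succ L ih =>
    intro p v m h
    by_cases hm : 0 < m
    · rw [avRec_of_pos n hm]
      refine (totalDegree_finsetSum _ _).trans (Finset.sup_le fun a ha => ?_)
      rw [Finset.mem_range] at ha
      unfold avTerm
      refine (totalDegree_mul _ _).trans ?_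
      refine (Nat.add_le_add (totalDegree_mul _ _) (ih (p + a + 1) (v + a) (m - 1 - a)
        (by omega))).trans ?_
      have hx : (xa k n (p + a) (v + m - 1)).totalDegree ≤ 1 := by
        unfold xa; split_ifs
        · exact (totalDegree_monomial_le _ _).trans (by simp)
        · simp
      have := ih p v a (by omega)
      omega
    · rw [show m = 0 by omega, avRec_zero]
      simp

/-- **The DP family `n ↦ A[0;0;n]` is a `VP` family** (Bürgisser 2000, Def. 2.4):
`n²` variables, degree `≤ n`, complexity `≤ 4(n+1)⁴`. [folklore] -/
theorem isVPFamily_avRec : IsVPFamily (fun n => avRec k n 0 0 n) := by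
  refine ⟨⟨?_, ?_⟩, ?_⟩
  · refine (isPBounded_iff_exists_polynomial_holds _).2 ⟨Polynomial.X ^ 2, fun n => ?_⟩
    simp [Fintype.card_prod, Fintype.card_fin, pow_two]
  · refine (isPBounded_iff_exists_polynomial_holds _).2 ⟨Polynomial.X, fun n => ?_⟩
    have := totalDegree_avRec_le (k := k) n n 0 0 n le_rfl
    simpa using this
  · refine (isPBounded_iff_exists_polynomial_holds _).2 ⟨4 * (Polynomial.X + 1) ^ 4, fun n => ?_⟩
    have := complexity_avRec_le (k := k) n
    simp only [Polynomial.eval_mul, Polynomial.eval_pow, Polynomial.eval_add, Polynomial.eval_X,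
      Polynomial.eval_ofNat, Polynomial.eval_one]
    exact this

end Summit.ValiantsHypothesis.ValiantsHypothesis.Theorems.FifoMatching

end
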